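import Mathlib
import Summits.Ventures.PercRepro2.K5K3Tables
import Summits.Ventures.PercRepro2.HCovTyped
import Summits.Ventures.PercRepro2.PMK5Deg2Kernel
import Summits.Ventures.PercRepro2.Deg2Kron
import Summits.Ventures.PercRepro2.SevenKernel
import Summits.Ventures.PercRepro2.SevenConn

/-!
# THE TWELVE FUNCTIONS OF `K₃` ON A SEVEN-VERTEX SKELETON ARE THE TABLES OF `SevenKernel.lean` — for EVERY edge list
(blind cell PercRepro2, mine-2 g34; `Deg2Tables.lean` (mine-2 g26) with the graph itself the parameter)

On the skeleton `ends edge` with the marks `(o, a₁, a₂, a₃, b) = (0, 1, 2, 3, 4)` the twelve functions of p1's kernel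
`K₃` (`HCovFns.lean`) are differences of the `0/1` tables: `1_{v∈C₁}`, `1_{v∈C₂}`, `1_Q`, `1_PD` are the tables
`tL v`, `tH v`, `tQ`, `tPD` (`iL_eq`, …, `iPD_eq3`, through `SevenConn.conn_iff`), and on `Q` no vertex lies in
both clusters (`conn12_of`), so each `f_i` is `f_i⁺ − f_i⁻` (`f3_eq`, …, `f12_eq`, by typer-1's Boolean identities
`K5.f3_bool`, …, `K5.f12_bool`, which are about Booleans only).  Hence **`K3_apply`**: `K₃ x y w` is the signed
sum of the twenty products of tables of `kPos` / `kNeg`, in the order `x, y, w`; `indR`, `indR_mul`,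
`coef3_eq_cnt3` are the seven-vertex copies of `Deg2Tables`' (the Kronecker objects `Deg2.cnt3`, `Hub.coef3` are
graph-independent).
-/

namespace Summit.Ventures.PercRepro2

open Hub

namespace Seven

section Tables

variable {R : Type*} [Field R] (edge : Fin 12 → Fin 7 × Fin 7)

/-- The `0/1` indicator of a table, as a function into `R`. -/
def indR (T : (Fin 12 → Bool) → Bool) : (Fin 12 → Bool) → R := fun ω => if T ω then 1 else 0

/-- The indicator of a set of configurations is `indR` of any table of the set. -/
lemma indicator_eq_indR (X : Set (Config (Fin 12))) (T : (Fin 12 → Bool) → Bool)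
    (hT : ∀ ω, T ω = true ↔ ω ∈ X) : X.indicator (1 : Config (Fin 12) → R) = indR T := by
  funext ω
  unfold indR
  by_cases h : ω ∈ X
  · rw [Set.indicator_of_mem h, if_pos ((hT ω).2 h)]
    rfl
  · rw [Set.indicator_of_notMem h, if_neg (fun h' => h ((hT ω).1 h'))]

/-- A product of three `0/1` values is the cast of the product of the bits. -/
lemma indR_mul (T₁ T₂ T₃ : (Fin 12 → Bool) → Bool) (a b c : Fin 12 → Bool) :
    (indR T₁ a : R) * indR T₂ b * indR T₃ c = (((T₁ a).toNat * (T₂ b).toNat * (T₃ c).toNat : ℕ) : R) := by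
  unfold indR
  cases T₁ a <;> cases T₂ b <;> cases T₃ c <;> simp

/-- The Bernstein coefficient of three tables is the cast of the triple count. -/
lemma coef3_eq_cnt3 (T₁ T₂ T₃ : (Fin 12 → Bool) → Bool) (k : Fin 12 → Fin 4) :
    coef3 (indR T₁) (indR T₂) (indR T₃) k = ((Deg2.cnt3 T₁ T₂ T₃ k : ℕ) : R) := by
  unfold coef3 Deg2.cnt3
  rw [Nat.cast_sum]
  exact Finset.sum_congr rfl fun t _ => indR_mul T₁ T₂ T₃ t.1 t.2.1 t.2.2

/-- `1_{v∈C₁}` is the table `L_v`. -/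
lemma iL_eq (v : Fin 7) : (CovForm.iL (ends edge) 1 v : Config (Fin 12) → R) = indR (tL edge v) :=
  indicator_eq_indR _ _ (tL_iff edge v)

/-- `1_{v∈C₂}` is the table `H_v`. -/
lemma iH_eq (v : Fin 7) : (CovForm.iH (ends edge) 2 v : Config (Fin 12) → R) = indR (tH edge v) :=
  indicator_eq_indR _ _ (tH_iff edge v)

/-- `1_Q` is the table `tQ`. -/
lemma iQ_eq3 : (CovForm.iQ (ends edge) 1 2 : Config (Fin 12) → R) = indR (tQ edge) :=
  indicator_eq_indR _ _ (tQ_iff edge)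

/-- `1_PD` is the table `tPD`. -/
lemma iPD_eq3 : (CovForm.iPD (ends edge) 1 2 3 : Config (Fin 12) → R) = indR (tPD edge) :=
  indicator_eq_indR _ _ (tPD_iff edge)

/-- `((3 : Fin 7) : ℕ) = 3`. -/
lemma val3 : ((3 : Fin 7) : ℕ) = 3 := rfl

/-- `((4 : Fin 7) : ℕ) = 4`. -/
lemma val4 : ((4 : Fin 7) : ℕ) = 4 := rfl

/-- **On `Q` no vertex lies in both clusters**: `v ∈ C₁` and `v ∈ C₂` force `a₁ ↔ a₂`. -/
lemma conn12_of (ω : Fin 12 → Bool) (v : Fin 7) (hL : conn edge ω 1 v = true)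
    (hH : conn edge ω 2 v = true) : conn edge ω 1 2 = true := by
  have h1 : Conn (ends edge) ω 1 v := (conn_iff edge ω 1 v).1 hL
  have h2 : Conn (ends edge) ω 2 v := (conn_iff edge ω 2 v).1 hH
  exact (conn_iff edge ω 1 2).2 (conn_trans h1 (conn_symm h2))

/-- `f₃ = 1_PD 1_{o∈U}` is the table `tPDoU`. -/
lemma f3_eq : (CovForm.f3 (ends edge) 0 1 2 3 : Config (Fin 12) → R) = indR (tPDoU edge) := by
  funext ω
  unfold CovForm.f3 CovForm.inU
  rw [iPD_eq3 edge, iL_eq edge, iH_eq edge]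
  unfold indR tPDoU tPD tQ tU tL tH
  exact K5.f3_bool _ _ _ _ _ (conn12_of edge ω 0)

/-- `f₄ = 1_Q σ_o σ_b` is `t4p − t4m`. -/
lemma f4_eq :
    (CovForm.f4 (ends edge) 0 1 2 4 : Config (Fin 12) → R) = fun ω => indR (t4p edge) ω - indR (t4m edge) ω := by
  funext ω
  unfold CovForm.f4 CovForm.sigma
  rw [iQ_eq3 edge, iL_eq edge, iH_eq edge, iL_eq edge, iH_eq edge]
  unfold indR t4p t4m tSame tOpp tQ tL tH
  exact K5.f4_bool _ _ _ _ _ (conn12_of edge ω 0) (conn12_of edge ω 4)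

/-- `f₅ = 1_Q σ₃ σ_b` is `t5p − t5m`. -/
lemma f5_eq :
    (CovForm.f5 (ends edge) 1 2 3 4 : Config (Fin 12) → R) = fun ω => indR (t5p edge) ω - indR (t5m edge) ω := by
  funext ω
  unfold CovForm.f5 CovForm.sigma
  rw [iQ_eq3 edge, iL_eq edge, iH_eq edge, iL_eq edge, iH_eq edge]
  unfold indR t5p t5m tSame tOpp tQ tL tH
  exact K5.f4_bool _ _ _ _ _ (conn12_of edge ω 3) (conn12_of edge ω 4)

/-- `f₆ = 1_Q σ₃ 1_{o∈U} σ_b` is `t6p − t6m`. -/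
lemma f6_eq :
    (CovForm.f6 (ends edge) 0 1 2 3 4 : Config (Fin 12) → R) = fun ω => indR (t6p edge) ω - indR (t6m edge) ω := by
  funext ω
  unfold CovForm.f6 CovForm.sigma CovForm.inU
  rw [iQ_eq3 edge, iL_eq edge, iH_eq edge, iL_eq edge, iH_eq edge, iL_eq edge, iH_eq edge]
  unfold indR t6p t6m tSame tOpp tU tQ tL tH
  exact K5.f6_bool _ _ _ _ _ _ _ (conn12_of edge ω 3) (conn12_of edge ω 0) (conn12_of edge ω 4)

/-- `f₇ = 1_Q σ_v` is `t7p v − t7m v`. -/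
lemma f7_eq (v : Fin 7) :
    (CovForm.f7 (ends edge) 1 2 v : Config (Fin 12) → R) = fun ω => indR (t7p edge v) ω - indR (t7m edge v) ω := by
  funext ω
  unfold CovForm.f7 CovForm.sigma
  rw [iQ_eq3 edge, iL_eq edge, iH_eq edge]
  unfold indR t7p t7m tQ tL tH
  exact K5.f7_bool _ _ _ (conn12_of edge ω v)

/-- `f₁₀ = 1_Q σ₃ 1_{o∈U}` is `t10p − t10m`. -/
lemma f10_eq :
    (CovForm.f10 (ends edge) 0 1 2 3 : Config (Fin 12) → R) = fun ω => indR (t10p edge) ω - indR (t10m edge) ω := by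
  funext ω
  unfold CovForm.f10 CovForm.sigma CovForm.inU
  rw [iQ_eq3 edge, iL_eq edge, iH_eq edge, iL_eq edge, iH_eq edge]
  unfold indR t10p t10m tU tQ tL tH
  exact K5.f10_bool _ _ _ _ _ (conn12_of edge ω 3) (conn12_of edge ω 0)

/-- `f₁₁ = 1_PD 1_{o∈U} 1_{b∈U}` is the table `t11`. -/
lemma f11_eq : (CovForm.f11 (ends edge) 0 1 2 3 4 : Config (Fin 12) → R) = indR (t11 edge) := by
  funext ω
  unfold CovForm.f11 CovForm.inU
  rw [iPD_eq3 edge, iL_eq edge, iH_eq edge, iL_eq edge, iH_eq edge]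
  unfold indR t11 tU tPD tQ tL tH
  exact K5.f11_bool _ _ _ _ _ _ _ (conn12_of edge ω 0) (conn12_of edge ω 4)

/-- `f₁₂ = 1_PD 1_{b∈U}` is the table `t12`. -/
lemma f12_eq : (CovForm.f12 (ends edge) 1 2 3 4 : Config (Fin 12) → R) = indR (t12 edge) := by
  funext ω
  unfold CovForm.f12 CovForm.inU
  rw [iPD_eq3 edge, iL_eq edge, iH_eq edge]
  unfold indR t12 tU tPD tQ tL tH
  exact K5.f12_bool _ _ _ _ _ (conn12_of edge ω 4)

/-- **The kernel `K₃` on the skeleton is the signed sum of twenty products of tables** (the ten positive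
products of `kPos`, then the ten negative products of `kNeg`, in the order `x, y, w`). -/
lemma K3_apply (a b c : Config (Fin 12)) :
    CovForm.K3 (R := R) (ends edge) 0 1 2 3 4 a b c =
      (indR (tPD edge) a * indR (tQ edge) b * indR (t4p edge) c + indR (tQ edge) a * indR (tPDoU edge) b * indR (t5p edge) c +
        indR (tPD edge) a * indR (tQ edge) b * indR (t6m edge) c +
        indR (tPD edge) a * indR (t7p edge 4) b * indR (t7m edge 0) c + indR (tPD edge) a * indR (t7m edge 4) b * indR (t7p edge 0) c +
        indR (tPDoU edge) a * indR (t7p edge 4) b * indR (t7m edge 3) c + indR (tPDoU edge) a * indR (t7m edge 4) b * indR (t7p edge 3) c +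
        indR (tPD edge) a * indR (t7p edge 4) b * indR (t10p edge) c + indR (tPD edge) a * indR (t7m edge 4) b * indR (t10m edge) c +
        indR (tQ edge) a * indR (t12 edge) b * indR (tPDoU edge) c) -
      (indR (tPD edge) a * indR (tQ edge) b * indR (t4m edge) c + indR (tQ edge) a * indR (tPDoU edge) b * indR (t5m edge) c +
        indR (tPD edge) a * indR (tQ edge) b * indR (t6p edge) c +
        indR (tPD edge) a * indR (t7p edge 4) b * indR (t7p edge 0) c + indR (tPD edge) a * indR (t7m edge 4) b * indR (t7m edge 0) c +
        indR (tPDoU edge) a * indR (t7p edge 4) b * indR (t7p edge 3) c + indR (tPDoU edge) a * indR (t7m edge 4) b * indR (t7m edge 3) c +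
        indR (tPD edge) a * indR (t7p edge 4) b * indR (t10m edge) c + indR (tPD edge) a * indR (t7m edge 4) b * indR (t10p edge) c +
        indR (tPD edge) a * indR (tQ edge) b * indR (t11 edge) c) := by
  unfold CovForm.K3 CovForm.sepKernel
  simp only [Fin.sum_univ_succ, Fin.sum_univ_zero, Matrix.cons_val_zero, Matrix.cons_val_succ,
    add_zero]
  rw [iPD_eq3 edge, iQ_eq3 edge, f3_eq edge, f4_eq edge, f5_eq edge, f6_eq edge, f7_eq edge, f7_eq edge, f7_eq edge, f10_eq edge,
    f11_eq edge, f12_eq edge]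
  simp only [val3, val4, Fin.val_zero]
  ring

end Tables

end Seven

end Summit.Ventures.PercRepro2
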